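import Mathlib
import Summits.CriticalPhenomena.CardyFormulaZ2.Theorems.CardyMagicRigidityDefs
import Summits.CriticalPhenomena.CardyFormulaZ2.Theorems.CardyMagicRigidityNestingRigidityFusionBaseCases
import Literature.Probability.RandomPlanarGeometry.LoopWinding
import Literature.Probability.RandomPlanarGeometry.LocFinLoopConfig
import HarnessLib

/-!
# Pattern counts are stable under `d_CN`-closeness (step (1) of stub `stub_treeRigidity`)

Crux `Summit.CriticalPhenomena.CardyFormulaZ2.Theses.CardyMagicRigidity.NestingRigidity`
(stmt-CriticalPhenomena-4835), line `positive-cone-weight-doubling`, registered stub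
`stub_treeRigidity` (doubly convergent regular limits + `NestingLawAgreement` ⇒
`d_CN(bond_{δₖ}, site_{δₖ}) → 0`).  Step (1) of its route is the a.s. continuity of the multi-disc
PATTERN COUNTS `N_S = patternCount` (loops inside the window `B(0, R)` surrounding exactly the closed
discs `B̄(x i, r i)`, `i ∈ S`, and avoiding the others) at the limit configuration.  This file proves
the DETERMINISTIC heart of that step, for two arbitrary typed configurations `c`, `c'` with
`d_CN(c, c') ≤ ε` in DKKMO's printed sense (`LoopConfig.IsClose ε c c'`):

* `patternCount_margin_le_of_isClose` (registered sub-goal) — with a margin `η ≥ ε` on the radii and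
  on the window (`R ≤ 1/ε`, so that the smaller window lies in the soft window of `d_CN`), every loop
  of `c` counted by `N_S(c; r + η, R − η)` has an `ε`-close partner of `c'` (`IsClose`), and the
  partner is counted by `N_S(c'; r, R)`: its trace lies in `B(0, R − η + ε) ⊆ B(0, R)`
  (`UnbasedLoop.range_subset_ball_of_udist_le`); every point of a thinner disc `B̄(x i, r i)` is at
  distance `> η ≥ ε` from the trace of the counted loop (the trace avoids the fattened disc: `W = 0` on
  the trace, `unbasedLoop_wind_of_mem_range`), so the winding numbers of the partner there are those of
  the loop up to a global sign (`UnbasedLoop.wind_eq_or_eq_neg_of_udist_lt`), and the partner's trace,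
  being within `ε` of the old trace (`UnbasedLoop.exists_mem_range_dist_le`), misses the thinner discs.
  The partner map is injective as soon as the counted loops of `c` are pairwise `> 2ε` apart in DKKMO's
  loop distance `udist` (`udist_triangle`), whence `N_S(c; r + η, R − η) ≤ N_S(c'; r, R)`
  (`Set.ncard_le_ncard_of_injOn`; the target set must be finite — `Set.ncard` of an infinite set is `0`).
* `patternCount_margin_le_of_isClose_of_forall` — the same with the separation hypothesis on all
  loops of `c` inside the smaller window (the form convenient for lattice configurations).
* `exists_pairwise_lt_udist` — a finite family of loops no two of which are time reversals of each
  other is uniformly separated in `udist` (`UnbasedLoop.udist_eq_zero_iff`): discharges the separation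
  hypothesis for finite counted families.  (Reversal pairs are a genuine obstruction: `d_CN` does not
  see the reversal closure, but `patternCount` counts `u` and `u.reverse` twice.)
* `le_diam_range_of_closedBall_subset`, `finite_patternLoops_of_isLocallyFinite` — a loop
  surrounding a closed disc of radius `ρ` has trace diameter `≥ ρ`, so in a locally finite
  configuration (`LoopConfig.IsLocallyFinite`, e.g. a `Regular` limit) the counted set of `N_S` is
  finite as soon as some disc `i ∈ S` has positive radius: discharges the finiteness hypothesis.
* `exists_forall_isClose_patternCount_margin_le` — the packaged form at a locally finite,
  reversal-free configuration `c`: for every margin `η > 0` there is `ε₀ > 0` such that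
  `N_S(c; r + η, R − η) ≤ N_S(c'; r, R)` whenever `d_CN(c, c') ≤ ε ≤ ε₀` and the counted set of `c'`
  is finite (lower semicontinuity of the counts under `d_CN`, up to margins).
-/

noncomputable section

open MeasureTheory Set Filter Metric
open scoped Real Topology BigOperators

namespace Summit.CriticalPhenomena.CardyFormulaZ2.Cruxes.NestingRigidity.PositiveConeWeightDoubling

open Literature.Probability.RandomPlanarGeometry Literature.Probability.Percolation
  Literature.Probability.LatticeModels
open Summit.CriticalPhenomena.CardyFormulaZ2.Cruxes.NestingRigidity.RingCloudTomography

/-! ## Distance from a thinner disc to a trace avoiding the fattened disc -/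

/-- If the trace of `u` avoids the closed disc `B̄(x, ρ + η)`, every point of the thinner disc
`B̄(x, ρ)` is at distance `> η` from the trace (the trace is compact and non-empty, so the infimum
is attained). -/
theorem lt_infDist_range_of_forall_notMem (u : UnbasedLoop ℂ) {x z : ℂ} {ρ η : ℝ}
    (hu : ∀ y ∈ u.range, y ∉ closedBall x (ρ + η)) (hz : z ∈ closedBall x ρ) :
    η < infDist z u.range := by
  obtain ⟨y, hy, hyz⟩ := u.isCompact_range.exists_infDist_eq_dist u.range_nonempty z
  rw [hyz]
  have h1 : ρ + η < dist y x := lt_of_not_ge fun h ↦ hu y hy (mem_closedBall.2 h)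
  have h2 : dist z x ≤ ρ := mem_closedBall.1 hz
  have h3 : dist y x ≤ dist z y + dist z x := dist_triangle_left y x z
  linarith

/-! ## The registered sub-goal: pattern counts with margins are dominated across `IsClose` -/

/-- **Pattern counts are stable under `d_CN`-closeness, with margins.**  Let `d_CN(c, c') ≤ ε`
(`LoopConfig.IsClose ε c c'`), `0 < ε ≤ η`, and let the window satisfy `R ≤ 1/ε`.  Suppose the loops
of `c` counted by `N_S(c; x, r + η, R − η)` (trace in `B(0, R − η)`, surrounding the fattened discs
`B̄(x i, r i + η)`, `i ∈ S`, avoiding the fattened discs `i ∉ S` together with their traces) are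
pairwise at `udist`-distance `> 2ε`, and that the set counted by `N_S(c'; x, r, R)` is finite.  Then
`N_S(c; x, r + η, R − η) ≤ N_S(c'; x, r, R)`: the `ε`-close partner (given by `IsClose`, of the same
type) of a counted loop of `c` is a counted loop of `c'`, and distinct counted loops have distinct
partners.  (Registered sub-goal of `stub_treeRigidity`; stated verbatim as registered.) -/
theorem patternCount_margin_le_of_isClose : ∀ {n : ℕ} (c c' : LoopConfig ℂ) (x : Fin n → ℂ)
    (r : Fin n → ℝ) (R ε η : ℝ) (S : Finset (Fin n)), 0 < ε → ε ≤ η → R ≤ 1 / ε →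
    LoopConfig.IsClose ε c c' →
    {u ∈ c.loops | u.range ⊆ Metric.ball (0 : ℂ) (R - η) ∧
      (∀ i ∈ S, Metric.closedBall (x i) (r i + η) ⊆ {w | u.wind w ≠ 0}) ∧
      ∀ i, i ∉ S → Disjoint (Metric.closedBall (x i) (r i + η))
        ({w | u.wind w ≠ 0} ∪ u.range)}.Pairwise (fun u v ↦ 2 * ε < u.udist v) →
    {u ∈ c'.loops | u.range ⊆ Metric.ball (0 : ℂ) R ∧
      (∀ i ∈ S, Metric.closedBall (x i) (r i) ⊆ {w | u.wind w ≠ 0}) ∧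
      ∀ i, i ∉ S → Disjoint (Metric.closedBall (x i) (r i)) ({w | u.wind w ≠ 0} ∪ u.range)}.Finite →
    patternCount c x (fun i ↦ r i + η) (R - η) S ≤ patternCount c' x r R S := by
  intro n c c' x r R ε η S hε hεη hR hclose hsep hfin
  classical
  set A : Set (UnbasedLoop ℂ) := {u ∈ c.loops | u.range ⊆ ball (0 : ℂ) (R - η) ∧
      (∀ i ∈ S, closedBall (x i) (r i + η) ⊆ {w | u.wind w ≠ 0}) ∧
      ∀ i, i ∉ S → Disjoint (closedBall (x i) (r i + η)) ({w | u.wind w ≠ 0} ∪ u.range)} with hA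
  set B : Set (UnbasedLoop ℂ) := {u ∈ c'.loops | u.range ⊆ ball (0 : ℂ) R ∧
      (∀ i ∈ S, closedBall (x i) (r i) ⊆ {w | u.wind w ≠ 0}) ∧
      ∀ i, i ∉ S → Disjoint (closedBall (x i) (r i)) ({w | u.wind w ≠ 0} ∪ u.range)} with hB
  -- the smaller window lies in the soft window `B(0, 1/ε)` of `d_CN`
  have hwin : ball (0 : ℂ) (R - η) ⊆ ball 0 (1 / ε) := ball_subset_ball (by linarith)
  -- partners: every counted loop of `c` has an `ε`-close loop of `c'` (of the same type)
  have hpartner : ∀ u, ∃ u', u ∈ A → u' ∈ c'.loops ∧ u.udist u' ≤ ε := by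
    intro u
    by_cases hu : u ∈ A
    · obtain ⟨hul, hur, -, -⟩ := hu
      rcases LoopConfig.mem_loops_iff.1 hul with h0 | h1
      · obtain ⟨u', hu', hd⟩ := (hclose 0).1 u h0 (hur.trans hwin)
        exact ⟨u', fun _ ↦ ⟨LoopConfig.subset_loops c' 0 hu', hd⟩⟩
      · obtain ⟨u', hu', hd⟩ := (hclose 1).1 u h1 (hur.trans hwin)
        exact ⟨u', fun _ ↦ ⟨LoopConfig.subset_loops c' 1 hu', hd⟩⟩
    · exact ⟨u, fun h ↦ (hu h).elim⟩
  choose f hf using hpartner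
  change A.ncard ≤ B.ncard
  refine Set.ncard_le_ncard_of_injOn f (fun u hu ↦ ?_) (fun u₁ hu₁ u₂ hu₂ heq ↦ ?_) hfin
  · -- the partner of a counted loop is counted
    obtain ⟨hu'l, hd⟩ := hf u hu
    obtain ⟨-, hur, hsur, havoid⟩ := hu
    refine ⟨hu'l, ?_, ?_, ?_⟩
    · -- (a) trace in the window
      exact (UnbasedLoop.range_subset_ball_of_udist_le hur hd).trans (ball_subset_ball (by linarith))
    · -- (b) the thinner discs `i ∈ S` are surrounded
      intro i hi z hz
      have htr : ∀ y ∈ u.range, y ∉ closedBall (x i) (r i + η) := fun y hy hy' ↦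
        hsur i hi hy' (unbasedLoop_wind_of_mem_range u hy)
      have hinf : η < infDist z u.range := lt_infDist_range_of_forall_notMem u htr hz
      have hz' : z ∈ closedBall (x i) (r i + η) := closedBall_subset_closedBall (by linarith) hz
      have hwz : u.wind z ≠ 0 := hsur i hi hz'
      show (f u).wind z ≠ 0
      rcases UnbasedLoop.wind_eq_or_eq_neg_of_udist_lt (hd.trans_lt (hεη.trans_lt hinf)) with h | h
      · rw [h]; exact hwz
      · rw [h]; exact neg_ne_zero.2 hwz
    · -- (c) the thinner discs `i ∉ S` are avoided, by the interior and by the trace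
      intro i hi
      have hdisj := havoid i hi
      rw [Set.disjoint_left] at hdisj ⊢
      intro z hz
      have hz' : z ∈ closedBall (x i) (r i + η) := closedBall_subset_closedBall (by linarith) hz
      have hzout := hdisj hz'
      have htr : ∀ y ∈ u.range, y ∉ closedBall (x i) (r i + η) := fun y hy hy' ↦
        hdisj hy' (Or.inr hy)
      have hinf : η < infDist z u.range := lt_infDist_range_of_forall_notMem u htr hz
      have hwz : u.wind z = 0 := by
        by_contra h
        exact hzout (Or.inl h)
      rintro (hw | hrange)
      · rcases UnbasedLoop.wind_eq_or_eq_neg_of_udist_lt (hd.trans_lt (hεη.trans_lt hinf)) with h | h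
        · exact hw (by rw [h, hwz])
        · exact hw (by rw [h, hwz, neg_zero])
      · obtain ⟨y, hy, hzy⟩ := UnbasedLoop.exists_mem_range_dist_le (f u) u hrange
        rw [UnbasedLoop.udist_comm] at hzy
        have : infDist z u.range ≤ dist z y := infDist_le_dist_of_mem hy
        linarith
  · -- (d) injectivity: two counted loops with the same partner are `≤ 2ε` apart
    by_contra hne
    have h := hsep hu₁ hu₂ hne
    have h1 := (hf u₁ hu₁).2
    have h2 := (hf u₂ hu₂).2
    have h3 := UnbasedLoop.udist_triangle u₁ (f u₁) u₂
    rw [heq] at h3 h1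
    rw [UnbasedLoop.udist_comm u₂] at h2
    linarith

/-- **The same, with the separation hypothesis on all loops of `c` inside the smaller window**
(pairwise `udist > 2ε` for distinct loops with trace in `B(0, R − η)`; e.g. a lattice configuration
at mesh `≫ ε`). -/
theorem patternCount_margin_le_of_isClose_of_forall {n : ℕ} (c c' : LoopConfig ℂ) (x : Fin n → ℂ)
    (r : Fin n → ℝ) (R ε η : ℝ) (S : Finset (Fin n)) (hε : 0 < ε) (hεη : ε ≤ η) (hR : R ≤ 1 / ε)
    (hclose : LoopConfig.IsClose ε c c')
    (hsep : ∀ u ∈ c.loops, ∀ v ∈ c.loops, u ≠ v → u.range ⊆ ball (0 : ℂ) (R - η) →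
      v.range ⊆ ball (0 : ℂ) (R - η) → 2 * ε < u.udist v)
    (hfin : {u ∈ c'.loops | u.range ⊆ ball (0 : ℂ) R ∧
        (∀ i ∈ S, closedBall (x i) (r i) ⊆ {w | u.wind w ≠ 0}) ∧
        ∀ i, i ∉ S → Disjoint (closedBall (x i) (r i)) ({w | u.wind w ≠ 0} ∪ u.range)}.Finite) :
    patternCount c x (fun i ↦ r i + η) (R - η) S ≤ patternCount c' x r R S :=
  patternCount_margin_le_of_isClose c c' x r R ε η S hε hεη hR hclose
    (fun u hu v hv hne ↦ hsep u hu.1 v hv.1 hne hu.2.1 hv.2.1) hfin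

/-! ## Discharging the separation hypothesis: finite reversal-free families -/

/-- **A finite family of loops, no two of which are time reversals of each other, is uniformly
separated in DKKMO's loop distance**: there is `δ > 0` with `udist u v > δ` for all distinct members
(`udist u v = 0 ↔ v = u ∨ v = u.reverse`, `UnbasedLoop.udist_eq_zero_iff`). -/
theorem exists_pairwise_lt_udist {E : Type*} [MetricSpace E] {A : Set (UnbasedLoop E)}
    (hA : A.Finite) (hrev : A.Pairwise fun u v ↦ v ≠ u.reverse) :
    ∃ δ : ℝ, 0 < δ ∧ A.Pairwise fun u v ↦ δ < u.udist v := by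
  set P : Set (UnbasedLoop E × UnbasedLoop E) := {p | p.1 ∈ A ∧ p.2 ∈ A ∧ p.1 ≠ p.2} with hP
  have hPfin : P.Finite := (hA.prod hA).subset fun p hp ↦ ⟨hp.1, hp.2.1⟩
  by_cases hPne : P.Nonempty
  · obtain ⟨p, hp, hmin⟩ := P.exists_min_image (fun p ↦ p.1.udist p.2) hPfin hPne
    have hpos : 0 < p.1.udist p.2 := by
      rcases (UnbasedLoop.udist_nonneg p.1 p.2).lt_or_eq with h | h
      · exact h
      · exfalso
        rcases UnbasedLoop.udist_eq_zero_iff.1 h.symm with h' | h'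
        · exact hp.2.2 h'.symm
        · exact hrev hp.1 hp.2.1 hp.2.2 h'
    refine ⟨p.1.udist p.2 / 2, by positivity, fun u hu v hv hne ↦ ?_⟩
    have := hmin (u, v) ⟨hu, hv, hne⟩
    dsimp only at this
    linarith
  · exact ⟨1, one_pos, fun u hu v hv hne ↦ (hPne ⟨(u, v), hu, hv, hne⟩).elim⟩

/-! ## Discharging the finiteness hypothesis: locally finite configurations -/

/-- **A loop surrounding a closed disc of radius `ρ` has trace diameter `≥ ρ`.**  The interior
`{W ≠ 0}` of a loop lies in every ball containing the trace
(`unbasedLoop_wind_eq_zero_of_subset_ball`), so every interior point is within `diam (trace)` of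
every trace point; two antipodal points of the disc are `2ρ` apart. -/
theorem le_diam_range_of_closedBall_subset {u : UnbasedLoop ℂ} {z : ℂ} {ρ : ℝ}
    (h : closedBall z ρ ⊆ {w | u.wind w ≠ 0}) : ρ ≤ diam u.range := by
  rcases lt_or_ge ρ 0 with hρ | hρ
  · exact hρ.le.trans diam_nonneg
  -- every interior point is within `diam` of every trace point
  have key : ∀ w, u.wind w ≠ 0 → ∀ y ∈ u.range, dist w y ≤ diam u.range := by
    intro w hw y hy
    by_contra hwy
    push Not at hwy
    refine hw (unbasedLoop_wind_eq_zero_of_subset_ball u (w := y) (ρ := dist w y) ?_ le_rfl)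
    intro y' hy'
    rw [mem_ball]
    exact (dist_le_diam_of_mem u.isCompact_range.isBounded hy' hy).trans_lt hwy
  obtain ⟨y, hy⟩ := u.range_nonempty
  have h1 : z + ρ ∈ closedBall z ρ := by
    rw [mem_closedBall, dist_eq_norm, add_sub_cancel_left, Complex.norm_real, Real.norm_eq_abs,
      abs_of_nonneg hρ]
  have h2 : z - ρ ∈ closedBall z ρ := by
    rw [mem_closedBall, dist_eq_norm, sub_sub_cancel_left, norm_neg, Complex.norm_real,
      Real.norm_eq_abs, abs_of_nonneg hρ]
  have d1 := key _ (h h1) y hy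
  have d2 := key _ (h h2) y hy
  have d3 : dist (z + ρ) (z - ρ) = 2 * ρ := by
    rw [dist_eq_norm, add_sub_sub_cancel, ← two_mul, norm_mul, Complex.norm_real,
      Real.norm_eq_abs, abs_of_nonneg hρ, Complex.norm_two]
  have d4 := dist_triangle (z + (ρ : ℂ)) y (z - ρ)
  rw [dist_comm y] at d4
  linarith

/-- **In a locally finite configuration the counted set of `N_S` is finite** as soon as some disc
`i ∈ S` has positive radius: a counted loop has its trace in the window `B(0, R)` and diameter
`≥ r i > 0` (`le_diam_range_of_closedBall_subset`), and `LoopConfig.IsLocallyFinite` allows only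
finitely many such loops of each type. -/
theorem finite_patternLoops_of_isLocallyFinite {c : LoopConfig ℂ} (hc : c.IsLocallyFinite) {n : ℕ}
    (x : Fin n → ℂ) (r : Fin n → ℝ) (R : ℝ) (S : Finset (Fin n)) {i : Fin n} (hi : i ∈ S)
    (hri : 0 < r i) :
    {u ∈ c.loops | u.range ⊆ ball (0 : ℂ) R ∧
        (∀ i ∈ S, closedBall (x i) (r i) ⊆ {w | u.wind w ≠ 0}) ∧
        ∀ i, i ∉ S → Disjoint (closedBall (x i) (r i)) ({w | u.wind w ≠ 0} ∪ u.range)}.Finite := by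
  refine ((hc 0 R (r i) hri).union (hc 1 R (r i) hri)).subset fun u hu ↦ ?_
  obtain ⟨hul, hur, hsur, -⟩ := hu
  have hd : r i ≤ diam u.range := le_diam_range_of_closedBall_subset (hsur i hi)
  rcases LoopConfig.mem_loops_iff.1 hul with h | h
  · exact Or.inl ⟨h, hur, hd⟩
  · exact Or.inr ⟨h, hur, hd⟩

/-- **Pattern counts of locally finite configurations are honest cardinalities**: under the
hypotheses of `finite_patternLoops_of_isLocallyFinite`, `patternCount` is the cardinality of a finite
set (not the junk value `0` of `Set.ncard` on infinite sets). -/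
theorem patternCount_eq_toFinset_card {c : LoopConfig ℂ} (hc : c.IsLocallyFinite) {n : ℕ}
    (x : Fin n → ℂ) (r : Fin n → ℝ) (R : ℝ) (S : Finset (Fin n)) {i : Fin n} (hi : i ∈ S)
    (hri : 0 < r i) :
    patternCount c x r R S = (finite_patternLoops_of_isLocallyFinite hc x r R S hi hri).toFinset.card :=
  Set.ncard_eq_toFinset_card _ _

/-! ## Packaging: locally finite reversal-free configurations -/

/-- **Lower semicontinuity of the pattern counts at a locally finite, reversal-free configuration,
with margins.**  If `c` is locally finite and contains no loop together with its time reversal, then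
for every margin `η > 0` and every disc family with some fattened disc `i ∈ S` non-degenerate
(`0 < r i + η`) there is `ε₀ > 0` such that for all `0 < ε ≤ ε₀` and every configuration `c'` with
`d_CN(c, c') ≤ ε` whose counted set is finite, `N_S(c; x, r + η, R − η) ≤ N_S(c'; x, r, R)`.
(The counted loops of `c` form a finite family by `finite_patternLoops_of_isLocallyFinite`, uniformly
`udist`-separated by `exists_pairwise_lt_udist`; then `patternCount_margin_le_of_isClose`.) -/
theorem exists_forall_isClose_patternCount_margin_le {c : LoopConfig ℂ} (hc : c.IsLocallyFinite)
    (hrev : c.loops.Pairwise fun u v ↦ v ≠ u.reverse) {n : ℕ} (x : Fin n → ℂ) (r : Fin n → ℝ)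
    (R η : ℝ) (hη : 0 < η) (S : Finset (Fin n)) {i : Fin n} (hi : i ∈ S) (hri : 0 < r i + η) :
    ∃ ε₀ : ℝ, 0 < ε₀ ∧ ∀ ε : ℝ, 0 < ε → ε ≤ ε₀ → ∀ c' : LoopConfig ℂ, LoopConfig.IsClose ε c c' →
      {u ∈ c'.loops | u.range ⊆ ball (0 : ℂ) R ∧
        (∀ i ∈ S, closedBall (x i) (r i) ⊆ {w | u.wind w ≠ 0}) ∧
        ∀ i, i ∉ S → Disjoint (closedBall (x i) (r i)) ({w | u.wind w ≠ 0} ∪ u.range)}.Finite →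
      patternCount c x (fun i ↦ r i + η) (R - η) S ≤ patternCount c' x r R S := by
  -- the counted loops of `c`: a finite, reversal-free, hence uniformly separated family
  have hAfin := finite_patternLoops_of_isLocallyFinite hc x (fun i ↦ r i + η) (R - η) S hi hri
  obtain ⟨δ, hδ, hsep⟩ := exists_pairwise_lt_udist hAfin (hrev.mono fun u hu ↦ hu.1)
  refine ⟨min (δ / 2) (min η (1 / max R 1)), by positivity, fun ε hε hεle c' hclose hfin ↦ ?_⟩
  have h1 : ε ≤ δ / 2 := hεle.trans (min_le_left _ _)
  have h2 : ε ≤ η := hεle.trans ((min_le_right _ _).trans (min_le_left _ _))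
  have h3 : ε ≤ 1 / max R 1 := hεle.trans ((min_le_right _ _).trans (min_le_right _ _))
  have hR : R ≤ 1 / ε := by
    have hm : 0 < max R 1 := lt_of_lt_of_le one_pos (le_max_right _ _)
    calc R ≤ max R 1 := le_max_left _ _
      _ ≤ 1 / ε := by
        rw [le_one_div hm hε]
        exact h3
  exact patternCount_margin_le_of_isClose c c' x r R ε η S hε h2 hR hclose
    (hsep.mono' fun u v h ↦ by linarith) hfin

end Summit.CriticalPhenomena.CardyFormulaZ2.Cruxes.NestingRigidity.PositiveConeWeightDoubling

end
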